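import Literature.AlgebraicGeometry.Resolution.BoundaryRestriction
import Literature.AlgebraicGeometry.Resolution.HasSNCStrictNormalCrossings
import Literature.AlgebraicGeometry.Resolution.KollarBoundaryCentre
import Literature.AlgebraicGeometry.Resolution.KollarStepThreeData
import Literature.AlgebraicGeometry.Resolution.MonomialMarkedIdeals
import Literature.AlgebraicGeometry.Resolution.ExcellentClosedSubschemes
import HarnessLib

/-!
# Crux `PatchingRelPerfect` (stmt-ResolutionOfSingularities-16161), chain W5.2 — F7(β) (β-AX) X3 C-I (M2b-T), (T-d): THE CARRIER PATCH —
# the carrier of a contact form as an F-60 ambient (`…DepthPhaseCContactCarrier`)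

[OURS · L1 W5.2 · F7(β) (β-AX) X3 C-I (M2b-T) · res-L1-w52-plan-1 RULING G12-32 (iii) (assembly input), hand res-D-repro-1 AS res-L1-repro-3]
The BOUNDARY CLAUSE of res-L1-w52-idea-1΄s `HasContactFormAt` (Sketch v18 §4.4: on the patch the carrier ideal `H` and the members through the
point form ONE simple normal crossings family `H :: BX`) turned into the AMBIENT DATA the named fact F-60
`CossartJannsenSaito2020EmbeddedSequenceBoundary` and the vehicle (T-a′) `ContactPushforward.vehicle` consume: the carrier `G = V(H)`
(`H.subscheme`, embedded by `H.subschemeι`) is a REGULAR closed subscheme whose ideal has ORDER-ONE stalk generators (the `hH` of the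
vehicle), it is EXCELLENT when the patch is, and the member traces `BX|_G` form a simple normal crossings family on `G`, whose union is a
STRICT NORMAL CROSSINGS DIVISOR `B ⊆ G` (the `B` of F-60).  Def-free; NOT a statement of the manuscript under review; AI-written, weaker than
expert review.  Literature files only (`HasSNC.exists_generator_notMem_sq`, `HasSNC.hasSNCWith_self`, `HasSNCWith.isRegular_subscheme`,
`hasSNC_filter_map_comap_subschemeι`, `HasSNC.isStrictNormalCrossingsDivisor_biUnion_support`, `Scheme.IsExcellent.of_isClosedImmersion`);
no fact, no sorry.

## References
* E. Bierstone, D. Grigoriev, P. Milman, J. Włodarczyk, *Effective Hironaka resolution …* (2011), Def. 3.1.1, Lemma 3.9.4 (1). [BierstoneGrigorievMilmanWlodarczyk2011]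
* V. Cossart, U. Jannsen, S. Saito, *Desingularization: Invariants and Strategy* (LNM 2270, 2020), Thm. 1.4 (the boundary `B`). [CossartJannsenSaito2020]
* H. Matsumura, *Commutative Ring Theory* (1987), §32 p. 260 (excellence of closed subschemes). [Matsumura1987]
-/

-- `Summit.<Summit>.<Sub>.Theorems` with `Sub = Summit` (single-conjunct summit, D-0017)
set_option linter.dupNamespace false

noncomputable section

open CategoryTheory AlgebraicGeometry TopologicalSpace IsLocalRing
open Literature.AlgebraicGeometry.Resolution
open Scheme.IdealSheafData

namespace Summit.ResolutionOfSingularities.ResolutionOfSingularities.Theorems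

namespace ContactCarrier

universe u

variable {Y : Scheme.{u}} {H : Y.IdealSheafData} {BX : List Y.IdealSheafData}

/-- [OURS · L1 W5.2 · (M2b-T) (T-d)] **The carrier ideal has ORDER-ONE stalk generators** along its embedding — the hypothesis `hH` of
`ContactPushforward.vehicle` / `CarrierGoingUp`. [cite: BierstoneGrigorievMilmanWlodarczyk2011, Def. 3.1.1] -/
theorem ker_subschemeι_generator (hsnc : HasSNC (H :: BX)) :
    ∀ x ∈ H.subschemeι.ker.support, ∃ v : Y.presheaf.stalk x,
      stalkIdeal H.subschemeι.ker x = Ideal.span {v} ∧ v ∉ (maximalIdeal (Y.presheaf.stalk x)) ^ 2 := by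
  rw [Scheme.IdealSheafData.ker_subschemeι]
  exact hsnc.exists_generator_notMem_sq List.mem_cons_self

/-- [OURS · L1 W5.2 · (M2b-T) (T-d)] **The carrier is a regular scheme.** [cite: BierstoneGrigorievMilmanWlodarczyk2011, Def. 3.1.1] -/
theorem isRegular_subscheme [IsLocallyNoetherian Y] (hsnc : HasSNC (H :: BX)) : Scheme.IsRegular H.subscheme :=
  (HasSNC.hasSNCWith_self hsnc H List.mem_cons_self).isRegular_subscheme

/-- [OURS · L1 W5.2 · (M2b-T) (T-d)] The carrier of an excellent patch is excellent (F-60 needs an excellent ambient).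
[cite: Matsumura1987, §32 p. 260] -/
theorem isExcellent_subscheme [IsLocallyNoetherian Y] (hY : Scheme.IsExcellent Y) : Scheme.IsExcellent H.subscheme :=
  Scheme.IsExcellent.of_isClosedImmersion H.subschemeι hY

/-- [OURS · L1 W5.2 · (M2b-T) (T-d)] **The member traces form a simple normal crossings family on the carrier** (BGMW Lemma 3.9.4 (1)).
[cite: BierstoneGrigorievMilmanWlodarczyk2011, Lemma 3.9.4 (1)] -/
theorem hasSNC_traces [DecidableEq Y.IdealSheafData] (hsnc : HasSNC (H :: BX)) :
    HasSNC ((BX.filter fun D => D ≠ H).map fun D => D.comap H.subschemeι) :=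
  hasSNC_filter_map_comap_subschemeι H BX hsnc

/-- [OURS · L1 W5.2 · (M2b-T) (T-d)] **The union of the member traces is a STRICT NORMAL CROSSINGS DIVISOR on the carrier** — the
boundary `B` handed to F-60 `CossartJannsenSaito2020EmbeddedSequenceBoundary`. [cite: CossartJannsenSaito2020, Thm. 1.4 (pp. 5–6)]
[cite: BierstoneGrigorievMilmanWlodarczyk2011, Def. 3.1.1] -/
theorem isStrictNormalCrossingsDivisor_traces [DecidableEq Y.IdealSheafData] (hsnc : HasSNC (H :: BX)) :
    IsStrictNormalCrossingsDivisor H.subscheme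
      (⋃ D ∈ (BX.filter fun D => D ≠ H).map (fun D => D.comap H.subschemeι), (D.support : Set H.subscheme)) :=
  (hasSNC_traces hsnc).isStrictNormalCrossingsDivisor_biUnion_support

/-- [OURS · L1 W5.2 · (M2b-T) (T-d)] The boundary as a subset of the carrier: a point of `G` lies on `B` iff its image lies on a member
other than the carrier. [folklore] -/
theorem mem_traces_iff [DecidableEq Y.IdealSheafData] (s : H.subscheme) :
    s ∈ (⋃ D ∈ (BX.filter fun D => D ≠ H).map (fun D => D.comap H.subschemeι), (D.support : Set H.subscheme)) ↔
      ∃ D ∈ BX, D ≠ H ∧ H.subschemeι s ∈ (D.support : Set Y) := by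
  simp only [Set.mem_iUnion, List.mem_map, List.mem_filter, decide_eq_true_eq, exists_prop]
  constructor
  · rintro ⟨_, ⟨D, ⟨hD, hne⟩, rfl⟩, hs⟩
    refine ⟨D, hD, hne, ?_⟩
    rw [Scheme.IdealSheafData.support_comap] at hs
    exact hs
  · rintro ⟨D, hD, hne, hs⟩
    refine ⟨D.comap H.subschemeι, ⟨D, ⟨hD, hne⟩, rfl⟩, ?_⟩
    rw [Scheme.IdealSheafData.support_comap]
    exact hs

/-- [OURS · L1 W5.2 · (M2b-T) (T-d)] **THE CARRIER PATCH, assembled**: the F-60 ambient data read off the boundary clause — carrier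
regular and excellent with order-one ideal generators, boundary `B` (the member traces) a strict normal crossings divisor.
[cite: CossartJannsenSaito2020, Thm. 1.4 (pp. 5–6)] [cite: BierstoneGrigorievMilmanWlodarczyk2011, Lemma 3.9.4 (1)] -/
theorem carrierPatch [IsLocallyNoetherian Y] [DecidableEq Y.IdealSheafData] (hY : Scheme.IsExcellent Y) (hsnc : HasSNC (H :: BX)) :
    Scheme.IsRegular H.subscheme ∧ Scheme.IsExcellent H.subscheme ∧
      (∀ x ∈ H.subschemeι.ker.support, ∃ v : Y.presheaf.stalk x,
        stalkIdeal H.subschemeι.ker x = Ideal.span {v} ∧ v ∉ (maximalIdeal (Y.presheaf.stalk x)) ^ 2) ∧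
      HasSNC ((BX.filter fun D => D ≠ H).map fun D => D.comap H.subschemeι) ∧
      IsStrictNormalCrossingsDivisor H.subscheme
        (⋃ D ∈ (BX.filter fun D => D ≠ H).map (fun D => D.comap H.subschemeι), (D.support : Set H.subscheme)) :=
  ⟨isRegular_subscheme hsnc, isExcellent_subscheme hY, ker_subschemeι_generator hsnc, hasSNC_traces hsnc,
    isStrictNormalCrossingsDivisor_traces hsnc⟩

end ContactCarrier

end Summit.ResolutionOfSingularities.ResolutionOfSingularities.Theorems

end
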